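import Mathlib
import Summits.Ventures.PercRepro2.Defs
import Summits.Ventures.PercRepro2.Independence
import Summits.Ventures.PercRepro2.Harris
import Summits.Ventures.PercRepro2.Graph
import Summits.Ventures.PercRepro2.Exploration
import Summits.Ventures.PercRepro2.Events
import Summits.Ventures.PercRepro2.FourFunctions
import Summits.Ventures.PercRepro2.Induced
import Summits.Ventures.PercRepro2.Frontier
import Summits.Ventures.PercRepro2.ObsIndependence
import Summits.Ventures.PercRepro2.BHK
import Summits.Ventures.PercRepro2.BHKEvents
import Summits.Ventures.PercRepro2.OrderPreservation
import Summits.Ventures.PercRepro2.BHKAvoid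
import Summits.Ventures.PercRepro2.SameClusterAvoid
import Summits.Ventures.PercRepro2.CaseOneRegime
import Summits.Ventures.PercRepro2.CaseOnePos
import Summits.Ventures.PercRepro2.CaseOneJ11
import Summits.Ventures.PercRepro2.CaseOneRV
import Summits.Ventures.PercRepro2.CaseOnePendant
import Summits.Ventures.PercRepro2.CaseOnePendantAny
import Summits.Ventures.PercRepro2.CaseOnePendantNec
import Summits.Ventures.PercRepro2.HullDefs
import Summits.Ventures.PercRepro2.OneEdge
import Summits.Ventures.PercRepro2.StarPattern
import Summits.Ventures.PercRepro2.HCov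
import Summits.Ventures.PercRepro2.HCovSwap
import Summits.Ventures.PercRepro2.OddsLemma
import Summits.Ventures.PercRepro2.RV
import Summits.Ventures.PercRepro2.RVBridge
import Summits.Ventures.PercRepro2.CaseOneDWorld
import Summits.Ventures.PercRepro2.CaseOneDWorldPin
import Summits.Ventures.PercRepro2.CaseOneDWorldLeaf

/-!
# The odds condition at a mixed threshold pair, and the pendant step of the degree-2 reduction
(blind cell PercRepro2, p1 g14; S5 §2.1 (K9), proofs/P1-DWORLD.md §2–§3)

The PD pair of a pendant `a₃` is the `r`-mixture of the Q pair and the PD pair of its neighbour `v`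
(`Dpd_leaf_supp` / `Dpdo_leaf_supp`, CaseOneDWorldLeaf.lean). At the Q pair the threshold condition
`c₁ P(Q, v ∈ C₁, o ∈ C₂) ≤ c₀ P(Q, v ∈ C₁)` is BHK 1.4 plus `{o ∈ C₂} ⊆ {o ∈ U}` (**`odds_q`**), at the PD
pair it is the odds lemma (`odds_pd`), hence it holds at every mixture (**`odds_mix`**). With identity (L)
this gives the pendant step: **`zSplitIID_of_leaf_supp`** — if `a₃` is a leaf at `v` in the support of
`p` and the D-world `(ii)` of `v` in `G − a₃` holds at the PD pair of `a₃`, then `ZSplitIID p (a₃)` (the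
Q-world term of (L) is nonnegative by the one-line lemma `iiExprT_nonneg_of_dworld`). Own code;
standard axioms.
-/

namespace Summit.Ventures.PercRepro2

namespace CaseOne

/-! ## The odds condition at a mixed pair, and the theorem -/

section Odds
variable {V : Type*} {E : Type*} [Fintype E] [DecidableEq E] [Fintype V] [DecidableEq V]
  {R : Type*} [Field R] [LinearOrder R] [IsStrictOrderedRing R]

/-- **The odds condition at the Q pair**: `P(Q) · P(Q, v ∈ C₁, o ∈ C₂) ≤ P(Q, o ∈ U) · P(Q, v ∈ C₁)`
(BHK 1.4 and `{o ∈ C₂} ⊆ {o ∈ U}`). -/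
theorem odds_q (p : E → R) (hp : IsProbVec p) (ends : E → Sym2 V) (o a₁ a₂ v : V) :
    prob p (connEvent ends a₁ a₂)ᶜ *
        prob p (connEvent ends a₁ v ∩ connEvent ends a₂ o ∩ (connEvent ends a₁ a₂)ᶜ) ≤
      Dqo p ends o a₁ a₂ * prob p (connEvent ends a₁ v ∩ (connEvent ends a₁ a₂)ᶜ) := by
  have h := bhk_cross_cluster p hp ends a₁ a₂ (isUpperSet_mem_setOf v) (isUpperSet_mem_setOf o)
  rw [← connEvent_eq_clusterInEvent ends a₁ v, ← connEvent_eq_clusterInEvent ends a₂ o] at h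
  have hmono : prob p (connEvent ends a₂ o ∩ (connEvent ends a₁ a₂)ᶜ) ≤ Dqo p ends o a₁ a₂ := by
    unfold Dqo
    exact prob_mono hp (fun ω h => ⟨Or.inr h.1, h.2⟩)
  have hA := prob_nonneg hp (connEvent ends a₁ v ∩ (connEvent ends a₁ a₂)ᶜ)
  calc prob p (connEvent ends a₁ a₂)ᶜ *
        prob p (connEvent ends a₁ v ∩ connEvent ends a₂ o ∩ (connEvent ends a₁ a₂)ᶜ)
      = prob p (connEvent ends a₁ v ∩ connEvent ends a₂ o ∩ (connEvent ends a₁ a₂)ᶜ) *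
        prob p (connEvent ends a₁ a₂)ᶜ := by ring
    _ ≤ prob p (connEvent ends a₁ v ∩ (connEvent ends a₁ a₂)ᶜ) *
        prob p (connEvent ends a₂ o ∩ (connEvent ends a₁ a₂)ᶜ) := h
    _ ≤ prob p (connEvent ends a₁ v ∩ (connEvent ends a₁ a₂)ᶜ) * Dqo p ends o a₁ a₂ :=
        mul_le_mul_of_nonneg_left hmono hA
    _ = Dqo p ends o a₁ a₂ * prob p (connEvent ends a₁ v ∩ (connEvent ends a₁ a₂)ᶜ) := by ring

/-- **The odds condition at every mixture of the Q pair and the PD pair of `v`.** -/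
theorem odds_mix (p : E → R) (hp : IsProbVec p) (ends : E → Sym2 V) (o a₁ a₂ v : V) (t : R)
    (ht0 : 0 ≤ t) (ht1 : t ≤ 1) :
    (t * Dpd p ends a₁ a₂ v + (1 - t) * prob p (connEvent ends a₁ a₂)ᶜ) *
        prob p (connEvent ends a₁ v ∩ connEvent ends a₂ o ∩ (connEvent ends a₁ a₂)ᶜ) ≤
      (t * Dpdo p ends o a₁ a₂ v + (1 - t) * Dqo p ends o a₁ a₂) *
        prob p (connEvent ends a₁ v ∩ (connEvent ends a₁ a₂)ᶜ) := by
  have h1 := odds_pd p hp ends o a₁ a₂ v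
  have h2 := odds_q p hp ends o a₁ a₂ v
  have h1' := mul_le_mul_of_nonneg_left h1 ht0
  have h2' := mul_le_mul_of_nonneg_left h2 (sub_nonneg.mpr ht1)
  nlinarith [h1', h2']

end Odds

section Theorem
variable {V : Type*} {E : Type*} [Fintype E] [DecidableEq E] [Fintype V] [DecidableEq V]
  {R : Type*} [Field R] [LinearOrder R] [IsStrictOrderedRing R]
variable {p : E → R} {ends : E → Sym2 V} {v a₃ : V} {e₀ : E}

/-- **The pendant step of the degree-2 reduction**: if `a₃` is a leaf at `v` in the support of `p`
and the D-world `(ii)` of `v` (in `G − a₃`, weights `p[e₀ ↦ 0]`) holds at the PD pair of `a₃`, then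
`ZSplitIID p (a₃)`. -/
theorem zSplitIID_of_leaf_supp (hp : IsProbVec p) (hl : IsLeafSupp p ends v a₃ e₀)
    {o a₁ a₂ b : V} (ho : o ≠ a₃) (h1 : a₁ ≠ a₃) (h2 : a₂ ≠ a₃) (hb : b ≠ a₃)
    (hv : 0 ≤ iiExprD (Function.update p e₀ 0) ends o a₁ a₂ v b (Dpdo p ends o a₁ a₂ a₃)
      (Dpd p ends a₁ a₂ a₃)) :
    ZSplitIID p ends o a₁ a₂ a₃ b := by
  unfold ZSplitIID
  rw [iiExprD_leaf_supp hl ho h1 h2 hb]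
  have hp' : IsProbVec (Function.update p e₀ 0) := hp.update e₀ le_rfl zero_le_one
  have hr0 : 0 ≤ p e₀ := hp.nonneg e₀
  have hr1 : 0 ≤ 1 - p e₀ := by linarith [hp.le_one e₀]
  -- the Q-world term at the mixed pair is nonnegative by the one-line lemma
  have hodds : Dpd p ends a₁ a₂ a₃ * prob (Function.update p e₀ 0)
      (connEvent ends a₁ v ∩ connEvent ends a₂ o ∩ (connEvent ends a₁ a₂)ᶜ) ≤
      Dpdo p ends o a₁ a₂ a₃ * prob (Function.update p e₀ 0)
        (connEvent ends a₁ v ∩ (connEvent ends a₁ a₂)ᶜ) := by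
    rw [Dpd_leaf_supp hl h1 h2, Dpdo_leaf_supp hl ho h1 h2]
    exact odds_mix (Function.update p e₀ 0) hp' ends o a₁ a₂ v (p e₀) hr0 (hp.le_one e₀)
  have hT := iiExprT_nonneg_of_dworld (Function.update p e₀ 0) hp' ends o a₁ a₂ v b _ _ hv hodds
  exact mul_nonneg hr0 (add_nonneg (mul_nonneg hr1 hT) (mul_nonneg hr0 hv))

end Theorem

end CaseOne

end Summit.Ventures.PercRepro2
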